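import Literature.InformationTheory.Entropy.KleinInequality
import Literature.MathematicalPhysics.QuantumLattice.KroneckerPartialTrace
import HarnessLib

/-!
# Subadditivity of the von Neumann entropy and the Araki–Lieb inequality
# (Watrous 2018, Theorems 5.24–5.25, Proposition 5.21, eqs. (5.108)–(5.110), (5.182))

Topic `InformationTheory/Entropy`, namespace `Literature.InformationTheory.Entropy`. Vocabulary: the tree's
`vonNeumannEntropy` (`H`), `quantumRelEntropy` (`D`, cfc-log so `log 0 = 0`), partial traces
`traceRight ρ = ρ[X] = Tr_Y ρ`, `traceLeft ρ = ρ[Y] = Tr_X ρ` (`QuantumMarginals.lean`), densities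
`IsDensity ρ` (`ρ ⪰ 0`, `Tr ρ = 1`), Mathlib's Kronecker product `⊗ₖ`; product vectors are written
`fun q => v q.1 * w q.2`. Everything is PROVED; no definition, no named fact. The printed proofs are
followed; the only work the source leaves implicit is the SUPPORT BOOKKEEPING that makes
`log(P ⊗ Q) = log P ⊗ 𝟙 + 𝟙 ⊗ log Q` ((5.108)) usable under the `log 0 = 0` convention, namely on
vectors in `im(ρ) ⊆ im(ρ[X] ⊗ ρ[Y])` ((5.109)).

* §1 **Functions of a Kronecker product against `ρ`** [cite: Watrous2018, Theorem 5.24 (proof, (5.108)–(5.109))]: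
  for Hermitian `A, B` and any `ρ` killing the product vectors `x ⊗ y` with `Ax = 0` or `By = 0`:
  `Tr(ρ f(A⊗B)) = Σ_{ij} f(a_i b_j) ⟨x_i⊗y_j, ρ(x_i⊗y_j)⟩` (`trace_mul_cfc_kronecker_eq_sum`), the
  weights vanish on kernel directions (`conj_kronecker_apply_eq_zero_left/right`), hence
  `Tr(ρ log(A⊗B)) = Tr(ρ(log A ⊗ 𝟙)) + Tr(ρ(𝟙 ⊗ log B))` (`trace_mul_log_kronecker`) and
  `ker(A ⊗ B) ⊆ ker ρ` (`mulVec_eq_zero_of_kronecker_mulVec_eq_zero`).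
* §2 **Marginal supports**: for `ρ ⪰ 0`, `(Tr_Y ρ) v = 0 ⟹ ρ(v ⊗ w) = 0` and symmetrically
  (`mulVec_prod_eq_zero_of_traceRight/Left`; the slices `⟨v⊗e_l, ρ(v⊗e_l)⟩ ≥ 0` sum to
  `⟨v, (Tr_Y ρ)v⟩ = 0`), and **(5.110)** `D(ρ ‖ ρ[X] ⊗ ρ[Y]) = H(ρ[X]) + H(ρ[Y]) − H(ρ)`
  (`quantumRelEntropy_kronecker_marginals`).
* §3 **Theorem 5.24 (subadditivity)** `H(ρ) ≤ H(ρ[X]) + H(ρ[Y])` for every state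
  (`vonNeumannEntropy_le_add_marginals`, by Klein's inequality `quantumRelEntropy_nonneg` of
  `KleinInequality.lean` exactly as printed; `mutualInformation_nonneg`), and **Theorem 5.25
  (Araki–Lieb)** `H(ρ[X]) ≤ H(ρ[Y]) + H(ρ)`, `H(ρ[Y]) ≤ H(ρ[X]) + H(ρ)`, `|H(ρ[X]) − H(ρ[Y])| ≤ H(ρ)`
  (`vonNeumannEntropy_traceRight_le`, `vonNeumannEntropy_traceLeft_le`,
  `abs_vonNeumannEntropy_marginals_sub_le`) by the printed purification argument: `ρ = MM⋆` with
  `M = √ρ`, the reshaped `N_{(y,z),x} = M_{(x,y),z}` has `N⋆N = ρ[X]ᵀ`, `Tr_Z(NN⋆) = ρ[Y]`,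
  `Tr_Y(NN⋆) = ρᵀ` ((5.116) via the tree's mirror lemma `vonNeumannEntropy_mul_conjTranspose_comm`),
  then subadditivity on `(Y, Z)`. [cite: Watrous2018, Theorems 5.24–5.25]
  [cite: NielsenChuang2010, §11.3.4 eqs. (11.72)–(11.73)]
* §4 **Proposition 5.21** `D(P₀⊗P₁ ‖ Q₀⊗Q₁) = Tr P₁·D(P₀‖Q₀) + Tr P₀·D(P₁‖Q₁)` for Hermitian operators
  with nested supports (`quantumRelEntropy_kronecker`; unit-trace form
  `quantumRelEntropy_kronecker_of_trace_eq_one`; (5.179) `D(P⊗ω‖Q⊗ω) = D(P‖Q)`,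
  `quantumRelEntropy_kronecker_right`), with `(A⊗B)(v⊗w) = Av ⊗ Bw` (`kronecker_mulVec_prod`,
  (1.68)). [cite: Watrous2018, Proposition 5.21]
* §5 **(5.182)** `D(ρ ‖ ω ⊗ ρ[Y]) = −H(ρ) + H(ρ[Y]) + log dim X`, `ω = 𝟙/dim X`
  (`quantumRelEntropy_uniform_kronecker_traceLeft`, from the common shape
  `quantumRelEntropy_kronecker_traceLeft`: `D(ρ ‖ A ⊗ ρ[Y]) = −H(ρ) − Re Tr(ρ[X] log A) + H(ρ[Y])`).
  [cite: Watrous2018, Theorem 5.36 (proof, eq. (5.182))] [cite: NielsenChuang2010, §11.4.1 eq. (11.106)]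

Not here: the equality cases (`H(X,Y) = H(X) + H(Y) ⟺ ρ = ρ[X] ⊗ ρ[Y]`; the "if" half is the tree's
`vonNeumannEntropy_kronecker`, `EntropyTensorAdditivity.lean`), (5.94)–(5.96) (in the tree as
`vonNeumannEntropy_fromBlocks_zero`, `vonNeumannEntropy_kronecker_eq`, `vonNeumannEntropy_kronecker`).

## Tree / Mathlib search (2026-08-31)

REUSED, not restated: `quantumRelEntropy_nonneg`, `re_trace_mul_cfc_log`, `quantumRelEntropy_self`
(`KleinInequality`, `VonNeumannEntropyInequalities`), `vonNeumannEntropy_mul_conjTranspose_comm`,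
`vonNeumannEntropy_transpose`, `vonNeumannEntropy_submatrix_equiv`, `traceLeft_submatrix_swap`,
`cfc_sqrt_mul_self` (Entropy files), `kronecker_mem_unitaryGroup`, `kronecker_conj_diagonal`
(`LinearAlgebra/Matrix/RelativeModularOperator`; its `cfc_log_kronecker` is the positive definite operator
identity (5.108)), `cfc_eq_conj_diagonal`, `trace_unitary_conj` (`HermitianCfcDiagonalForm`),
`trace_mul_traceRight/Left_eq_kronecker`, `posSemidef_traceLeft/Right`, `isDensity_traceLeft/Right`
(`QuantumLattice/KroneckerPartialTrace`). The tree had subadditivity only for even LATTICE-FERMION states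
(`QuantumLattice/FermionBoxSubadditivity`, Araki–Moriya) and strong subadditivity / weak monotonicity in
the `X × S × Y` vocabulary (`WeakMonotonicityFromRelEntropy`); `rg -il "araki-lieb|araki–lieb|triangle
inequality.*entropy|subadditiv"` over `Literature/{InformationTheory,MathematicalPhysics/QuantumLattice,
Computability/QuantumComplexity,LinearAlgebra}` and an FQN scan of every public name below found no tensor-product
statement of Theorems 5.24/5.25, Proposition 5.21 or (5.110)/(5.182). Mathlib: `Matrix.PosSemidef.kronecker`,
`Matrix.trace_kronecker`, `Matrix.mul_kronecker_mul`, `Matrix.PosSemidef.dotProduct_mulVec_zero_iff`,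
`Finset.sum_eq_zero_iff_of_nonneg`.

## References

* J. Watrous, *The Theory of Quantum Information* (CUP 2018), §1.1.2 eq. (1.68); §5.2.2 Propositions
  5.20–5.21, Theorems 5.24–5.25, eqs. (5.106)–(5.117); §5.2.3 proof of Theorem 5.36, eqs. (5.182)–(5.183).
  [Watrous2018]
* M. A. Nielsen, I. L. Chuang, *Quantum Computation and Quantum Information* (CUP 2010), §11.3.4
  (subadditivity and the Araki–Lieb triangle inequality), §11.4.1 eq. (11.106). [NielsenChuang2010]
-/

noncomputable section

open Matrix
open scoped BigOperators ComplexOrder Kronecker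

namespace Literature.InformationTheory.Entropy

open Literature.Computability.QuantumComplexity (traceLeft traceRight IsDensity traceLeft_apply
  traceRight_apply trace_traceLeft trace_traceRight)
open Literature.LinearAlgebra.Matrix (cfc_eq_conj_diagonal trace_unitary_conj isHermitian_cfc
  kronecker_mem_unitaryGroup kronecker_conj_diagonal)
open Literature.MathematicalPhysics.QuantumLattice (trace_mul_traceRight_eq_kronecker
  trace_mul_traceLeft_eq_kronecker posSemidef_traceLeft posSemidef_traceRight isDensity_traceLeft
  isDensity_traceRight)

variable {m n : Type*} [Fintype m] [DecidableEq m] [Fintype n] [DecidableEq n]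

/-! ### §1 Traces against functions of a Kronecker product, with support bookkeeping -/

section KroneckerSupport

/-- `Tr (ρ · U D U⋆) = Σ_p D_p (U⋆ ρ U)_{pp}` for a unitary `U` and a diagonal `D`. [folklore] -/
private theorem trace_mul_conj_diagonal_eq_sum {k : Type*} [Fintype k] [DecidableEq k]
    (ρ U : Matrix k k ℂ) (hU : U ∈ Matrix.unitaryGroup k ℂ) (g : k → ℂ) :
    (ρ * (U * diagonal g * star U)).trace = ∑ p, g p * (star U * ρ * U) p p := by
  have h1 : star U * U = 1 := Unitary.star_mul_self_of_mem hU
  have hcyc : (ρ * (U * diagonal g * star U)).trace = (star U * ρ * U * diagonal g).trace := by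
    rw [← trace_unitary_conj (Unitary.star_mem hU) (ρ * (U * diagonal g * star U)), star_star]
    congr 1
    simp only [Matrix.mul_assoc]
    rw [h1, Matrix.mul_one]
  rw [hcyc, Matrix.trace]
  refine Finset.sum_congr rfl fun p _ => ?_
  rw [Matrix.diag_apply, Matrix.mul_diagonal, mul_comm]

/-- The diagonal entry `(U⋆ ρ U)_{pp}` is the quadratic form of `ρ` at the `p`-th column of `U`.
[folklore] -/
private theorem conj_apply_eq_dotProduct_mulVec {k : Type*} [Fintype k] (ρ U : Matrix k k ℂ) (p : k) :
    (star U * ρ * U) p p = star (fun q => U q p) ⬝ᵥ (ρ *ᵥ fun q => U q p) := by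
  simp only [Matrix.mul_apply, dotProduct, Matrix.mulVec, Matrix.star_apply, Pi.star_apply,
    Finset.sum_mul, Finset.mul_sum, mul_assoc]
  exact Finset.sum_comm

/-- Columns of a unitary diagonalisation are eigenvectors: `A = V diag(a) V⋆ ⟹ A x_i = a_i x_i`.
[cite: Watrous2018, Corollary 1.4 eq. (1.137)] -/
theorem mulVec_col_of_conj_diagonal {k : Type*} [Fintype k] [DecidableEq k] {A V : Matrix k k ℂ}
    (hV : V ∈ Matrix.unitaryGroup k ℂ) {a : k → ℝ}
    (hAV : A = V * diagonal (fun i => ((a i : ℝ) : ℂ)) * star V) (i : k) :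
    A *ᵥ (fun q => V q i) = ((a i : ℝ) : ℂ) • (fun q => V q i) := by
  have hAVmul : A * V = V * diagonal (fun i => ((a i : ℝ) : ℂ)) := by
    rw [hAV, Matrix.mul_assoc (V * _), Unitary.star_mul_self_of_mem hV, Matrix.mul_one]
  funext q
  have h : (A * V) q i = (V * diagonal (fun i => ((a i : ℝ) : ℂ))) q i := by rw [hAVmul]
  rw [Matrix.mul_apply, Matrix.mul_diagonal] at h
  simp only [Matrix.mulVec, dotProduct, Pi.smul_apply, smul_eq_mul]
  rw [h, mul_comm]

omit [Fintype m] [DecidableEq m] [Fintype n] [DecidableEq n] in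
/-- The `(i,j)`-th column of `V ⊗ₖ W` is the product vector `x_i ⊗ y_j`. [folklore] -/
private theorem kronecker_col (V : Matrix m m ℂ) (W : Matrix n n ℂ) (p : m × n) :
    (fun q : m × n => (V ⊗ₖ W) q p) = fun q => V q.1 p.1 * W q.2 p.2 := by
  funext q; rfl

/-- **Trace against a function of a Kronecker product splits on the support.** Let
`A = V diag(a) V⋆`, `B = W diag(b) W⋆` be Hermitian and let `ρ` kill every product vector `x ⊗ y`
with `A x = 0` or `B y = 0`. Then for every `f`,
`Tr(ρ f(A ⊗ B)) = Σ_{(i,j)} f(a_i b_j) r_{ij}` with `r_{ij} = ⟨x_i ⊗ y_j, ρ (x_i ⊗ y_j)⟩` vanishing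
whenever `a_i = 0` or `b_j = 0` — the bookkeeping behind Watrous' use of
`log(P ⊗ Q) = log P ⊗ 𝟙 + 𝟙 ⊗ log Q` on `im(ρ)` ((5.108)–(5.109)).
[cite: Watrous2018, Theorem 5.24 (proof, eqs. (5.108)–(5.110))] -/
theorem trace_mul_cfc_kronecker_eq_sum {A V : Matrix m m ℂ} {B W : Matrix n n ℂ}
    (hV : V ∈ Matrix.unitaryGroup m ℂ) (hW : W ∈ Matrix.unitaryGroup n ℂ) {a : m → ℝ} {b : n → ℝ}
    (hAV : A = V * diagonal (fun i => ((a i : ℝ) : ℂ)) * star V)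
    (hBW : B = W * diagonal (fun j => ((b j : ℝ) : ℂ)) * star W) (ρ : Matrix (m × n) (m × n) ℂ)
    (f : ℝ → ℝ) :
    (ρ * cfc f (A ⊗ₖ B)).trace =
      ∑ p : m × n, ((f (a p.1 * b p.2) : ℝ) : ℂ) * (star (V ⊗ₖ W) * ρ * (V ⊗ₖ W)) p p := by
  have hUW := kronecker_mem_unitaryGroup hV hW
  have hAB : A ⊗ₖ B = (V ⊗ₖ W) * diagonal (fun p : m × n => ((a p.1 * b p.2 : ℝ) : ℂ)) *
      star (V ⊗ₖ W) := by
    rw [hAV, hBW]; exact kronecker_conj_diagonal V W a b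
  rw [cfc_eq_conj_diagonal hUW hAB f, trace_mul_conj_diagonal_eq_sum ρ _ hUW]
  rfl

omit [DecidableEq n] in
/-- Under the support hypotheses, the diagonal weight `r_{ij} = ⟨x_i ⊗ y_j, ρ(x_i ⊗ y_j)⟩` vanishes
when `a_i = 0`. [cite: Watrous2018, Theorem 5.24 (proof, eq. (5.109))] -/
theorem conj_kronecker_apply_eq_zero_left {A V : Matrix m m ℂ} {W : Matrix n n ℂ}
    (hV : V ∈ Matrix.unitaryGroup m ℂ) {a : m → ℝ}
    (hAV : A = V * diagonal (fun i => ((a i : ℝ) : ℂ)) * star V) {ρ : Matrix (m × n) (m × n) ℂ}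
    (hA : ∀ (v : m → ℂ) (w : n → ℂ), A *ᵥ v = 0 → ρ *ᵥ (fun q : m × n => v q.1 * w q.2) = 0)
    {p : m × n} (hp : a p.1 = 0) :
    (star (V ⊗ₖ W) * ρ * (V ⊗ₖ W)) p p = 0 := by
  rw [conj_apply_eq_dotProduct_mulVec, kronecker_col]
  have hx : A *ᵥ (fun q => V q p.1) = 0 := by
    rw [mulVec_col_of_conj_diagonal hV hAV p.1, hp, Complex.ofReal_zero, zero_smul]
  rw [hA _ (fun q => W q p.2) hx, dotProduct_zero]

omit [DecidableEq m] in
/-- Under the support hypotheses, `r_{ij}` vanishes when `b_j = 0`.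
[cite: Watrous2018, Theorem 5.24 (proof, eq. (5.109))] -/
theorem conj_kronecker_apply_eq_zero_right {V : Matrix m m ℂ} {B W : Matrix n n ℂ}
    (hW : W ∈ Matrix.unitaryGroup n ℂ) {b : n → ℝ}
    (hBW : B = W * diagonal (fun j => ((b j : ℝ) : ℂ)) * star W) {ρ : Matrix (m × n) (m × n) ℂ}
    (hB : ∀ (v : m → ℂ) (w : n → ℂ), B *ᵥ w = 0 → ρ *ᵥ (fun q : m × n => v q.1 * w q.2) = 0)
    {p : m × n} (hp : b p.2 = 0) :
    (star (V ⊗ₖ W) * ρ * (V ⊗ₖ W)) p p = 0 := by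
  rw [conj_apply_eq_dotProduct_mulVec, kronecker_col]
  have hy : B *ᵥ (fun q => W q p.2) = 0 := by
    rw [mulVec_col_of_conj_diagonal hW hBW p.2, hp, Complex.ofReal_zero, zero_smul]
  rw [hB (fun q => V q p.1) _ hy, dotProduct_zero]

/-- **`Tr(ρ log(A ⊗ B)) = Tr(ρ (log A ⊗ 𝟙)) + Tr(ρ (𝟙 ⊗ log B))` on the support**: for Hermitian
`A, B` and any `ρ` killing the product vectors `x ⊗ y` with `A x = 0` or `B y = 0` (so that, with the
tree's `log 0 = 0`, the three logarithms agree on `im ρ`). For positive definite `A, B` the operator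
identity itself is the tree's `Literature.LinearAlgebra.Matrix.cfc_log_kronecker`.
[cite: Watrous2018, Theorem 5.24 (proof, eqs. (5.108)–(5.109))] -/
theorem trace_mul_log_kronecker {A : Matrix m m ℂ} {B : Matrix n n ℂ} (hA : A.IsHermitian)
    (hB : B.IsHermitian) {ρ : Matrix (m × n) (m × n) ℂ}
    (hkA : ∀ (v : m → ℂ) (w : n → ℂ), A *ᵥ v = 0 → ρ *ᵥ (fun q : m × n => v q.1 * w q.2) = 0)
    (hkB : ∀ (v : m → ℂ) (w : n → ℂ), B *ᵥ w = 0 → ρ *ᵥ (fun q : m × n => v q.1 * w q.2) = 0) :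
    (ρ * cfc Real.log (A ⊗ₖ B)).trace =
      (ρ * (cfc Real.log A ⊗ₖ (1 : Matrix n n ℂ))).trace +
        (ρ * ((1 : Matrix m m ℂ) ⊗ₖ cfc Real.log B)).trace := by
  obtain ⟨V, hVdef⟩ : ∃ V : Matrix m m ℂ, V = (hA.eigenvectorUnitary : Matrix m m ℂ) := ⟨_, rfl⟩
  obtain ⟨W, hWdef⟩ : ∃ W : Matrix n n ℂ, W = (hB.eigenvectorUnitary : Matrix n n ℂ) := ⟨_, rfl⟩
  have hV : V ∈ Matrix.unitaryGroup m ℂ := hVdef ▸ hA.eigenvectorUnitary.2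
  have hW : W ∈ Matrix.unitaryGroup n ℂ := hWdef ▸ hB.eigenvectorUnitary.2
  have hAV : A = V * diagonal (fun i => ((hA.eigenvalues i : ℝ) : ℂ)) * star V := by
    rw [hVdef]; exact hA.spectral_theorem
  have hBW : B = W * diagonal (fun j => ((hB.eigenvalues j : ℝ) : ℂ)) * star W := by
    rw [hWdef]; exact hB.spectral_theorem
  have hUW := kronecker_mem_unitaryGroup hV hW
  -- `log A ⊗ 1` and `1 ⊗ log B` in the product eigenbasis
  have h1m : (1 : Matrix m m ℂ) = V * diagonal (fun _ => (((1 : ℝ) : ℝ) : ℂ)) * star V := by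
    rw [Complex.ofReal_one, diagonal_one, Matrix.mul_one, Unitary.mul_star_self_of_mem hV]
  have h1n : (1 : Matrix n n ℂ) = W * diagonal (fun _ => (((1 : ℝ) : ℝ) : ℂ)) * star W := by
    rw [Complex.ofReal_one, diagonal_one, Matrix.mul_one, Unitary.mul_star_self_of_mem hW]
  have hlogA : cfc Real.log A ⊗ₖ (1 : Matrix n n ℂ) = (V ⊗ₖ W) *
      diagonal (fun p : m × n => ((Real.log (hA.eigenvalues p.1) * 1 : ℝ) : ℂ)) * star (V ⊗ₖ W) := by
    rw [cfc_eq_conj_diagonal hV hAV Real.log, h1n]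
    exact kronecker_conj_diagonal V W (fun i => Real.log (hA.eigenvalues i)) (fun _ => (1 : ℝ))
  have hlogB : (1 : Matrix m m ℂ) ⊗ₖ cfc Real.log B = (V ⊗ₖ W) *
      diagonal (fun p : m × n => ((1 * Real.log (hB.eigenvalues p.2) : ℝ) : ℂ)) * star (V ⊗ₖ W) := by
    rw [cfc_eq_conj_diagonal hW hBW Real.log, h1m]
    exact kronecker_conj_diagonal V W (fun _ => (1 : ℝ)) (fun j => Real.log (hB.eigenvalues j))
  rw [trace_mul_cfc_kronecker_eq_sum hV hW hAV hBW ρ Real.log, hlogA, hlogB,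
    trace_mul_conj_diagonal_eq_sum ρ _ hUW, trace_mul_conj_diagonal_eq_sum ρ _ hUW,
    ← Finset.sum_add_distrib]
  refine Finset.sum_congr rfl fun p _ => ?_
  rw [← add_mul, mul_one, one_mul]
  rcases eq_or_ne (hA.eigenvalues p.1) 0 with ha | ha
  · rw [conj_kronecker_apply_eq_zero_left hV hAV hkA ha, mul_zero, mul_zero]
  rcases eq_or_ne (hB.eigenvalues p.2) 0 with hb | hb
  · rw [conj_kronecker_apply_eq_zero_right hW hBW hkB hb, mul_zero, mul_zero]
  rw [Real.log_mul ha hb, Complex.ofReal_add]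

/-- **`ker(A ⊗ B) ⊆ ker ρ` under the support hypotheses** (Watrous (5.109):
`im(ρ) ⊆ im(ρ[X] ⊗ ρ[Y])`): if `ρ` kills every product vector `x ⊗ y` with `A x = 0` or `B y = 0`
then `(A ⊗ B) v = 0 ⟹ ρ v = 0`. [cite: Watrous2018, Theorem 5.24 (proof, eq. (5.109))] -/
theorem mulVec_eq_zero_of_kronecker_mulVec_eq_zero {A : Matrix m m ℂ} {B : Matrix n n ℂ}
    (hA : A.IsHermitian) (hB : B.IsHermitian) {ρ : Matrix (m × n) (m × n) ℂ}
    (hkA : ∀ (v : m → ℂ) (w : n → ℂ), A *ᵥ v = 0 → ρ *ᵥ (fun q : m × n => v q.1 * w q.2) = 0)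
    (hkB : ∀ (v : m → ℂ) (w : n → ℂ), B *ᵥ w = 0 → ρ *ᵥ (fun q : m × n => v q.1 * w q.2) = 0)
    (v : m × n → ℂ) (hv : (A ⊗ₖ B) *ᵥ v = 0) : ρ *ᵥ v = 0 := by
  obtain ⟨V, hVdef⟩ : ∃ V : Matrix m m ℂ, V = (hA.eigenvectorUnitary : Matrix m m ℂ) := ⟨_, rfl⟩
  obtain ⟨W, hWdef⟩ : ∃ W : Matrix n n ℂ, W = (hB.eigenvectorUnitary : Matrix n n ℂ) := ⟨_, rfl⟩
  have hV : V ∈ Matrix.unitaryGroup m ℂ := hVdef ▸ hA.eigenvectorUnitary.2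
  have hW : W ∈ Matrix.unitaryGroup n ℂ := hWdef ▸ hB.eigenvectorUnitary.2
  have hAV : A = V * diagonal (fun i => ((hA.eigenvalues i : ℝ) : ℂ)) * star V := by
    rw [hVdef]; exact hA.spectral_theorem
  have hBW : B = W * diagonal (fun j => ((hB.eigenvalues j : ℝ) : ℂ)) * star W := by
    rw [hWdef]; exact hB.spectral_theorem
  obtain ⟨U, hUdef⟩ : ∃ U : Matrix (m × n) (m × n) ℂ, U = V ⊗ₖ W := ⟨_, rfl⟩
  have hU : U ∈ Matrix.unitaryGroup (m × n) ℂ := hUdef ▸ kronecker_mem_unitaryGroup hV hW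
  have hU1 : U * star U = 1 := Unitary.mul_star_self_of_mem hU
  have hU2 : star U * U = 1 := Unitary.star_mul_self_of_mem hU
  obtain ⟨D, hDdef⟩ : ∃ D : Matrix (m × n) (m × n) ℂ,
    D = diagonal (fun p : m × n => ((hA.eigenvalues p.1 * hB.eigenvalues p.2 : ℝ) : ℂ)) := ⟨_, rfl⟩
  have hAB : A ⊗ₖ B = U * D * star U := by
    rw [hAV, hBW, hUdef, hDdef]; exact kronecker_conj_diagonal V W _ _
  -- coordinates of `v` in the product eigenbasis
  obtain ⟨c, hcdef⟩ : ∃ c : m × n → ℂ, c = star U *ᵥ v := ⟨_, rfl⟩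
  have hvc : v = U *ᵥ c := by rw [hcdef, Matrix.mulVec_mulVec, hU1, Matrix.one_mulVec]
  have hDc : D *ᵥ c = 0 := by
    have h : star U *ᵥ ((A ⊗ₖ B) *ᵥ v) = 0 := by rw [hv, Matrix.mulVec_zero]
    have hmat : star U * (U * D * star U) = D * star U := by
      rw [← Matrix.mul_assoc, ← Matrix.mul_assoc, hU2, Matrix.one_mul]
    rwa [hAB, Matrix.mulVec_mulVec, hmat, ← Matrix.mulVec_mulVec, ← hcdef] at h
  -- each product eigenvector with a nonzero coefficient is killed by `ρ`
  have hcol : ∀ p : m × n, c p ≠ 0 → ρ *ᵥ (fun q => U q p) = 0 := by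
    intro p hcp
    have hDp : ((hA.eigenvalues p.1 * hB.eigenvalues p.2 : ℝ) : ℂ) * c p = 0 := by
      have := congrFun hDc p
      rwa [hDdef, Matrix.mulVec_diagonal] at this
    rcases mul_eq_zero.1 hDp with h0 | h0
    · rw [hUdef, kronecker_col]
      rcases mul_eq_zero.1 (Complex.ofReal_eq_zero.1 h0) with ha | hb
      · exact hkA (fun q => V q p.1) (fun q => W q p.2)
          (by rw [mulVec_col_of_conj_diagonal hV hAV p.1, ha, Complex.ofReal_zero, zero_smul])
      · exact hkB (fun q => V q p.1) (fun q => W q p.2)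
          (by rw [mulVec_col_of_conj_diagonal hW hBW p.2, hb, Complex.ofReal_zero, zero_smul])
    · exact absurd h0 hcp
  -- expand `ρ v = (ρU) c` column by column
  rw [hvc, Matrix.mulVec_mulVec]
  funext q
  simp only [Matrix.mulVec, dotProduct, Pi.zero_apply]
  refine Finset.sum_eq_zero fun p _ => ?_
  by_cases hcp : c p = 0
  · rw [hcp, mul_zero]
  · have h := congrFun (hcol p hcp) q
    simp only [Matrix.mulVec, dotProduct, Pi.zero_apply] at h
    rw [Matrix.mul_apply, h, zero_mul]

end KroneckerSupport

/-! ### §2 Marginals: the support of a state lies in the support of the product of its marginals -/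

section Marginals

omit [Fintype m] [DecidableEq m] [Fintype n] in
/-- The slice vector `v ⊗ e_l` has self-adjoint indicator factor. [folklore] -/
private theorem star_prod_single (v : m → ℂ) (l : n) :
    star (fun q : m × n => v q.1 * (Pi.single l (1 : ℂ) : n → ℂ) q.2) =
      fun q : m × n => star (v q.1) * (Pi.single l (1 : ℂ) : n → ℂ) q.2 := by
  funext q
  simp only [Pi.star_apply, star_mul', Pi.single_apply]
  split_ifs <;> simp

omit [DecidableEq m] in
/-- A slice of the quadratic form: `⟨v ⊗ e_l, ρ (v ⊗ e_l)⟩ = Σ_{k,k'} conj(v_k) ρ_{(k,l),(k',l)} v_{k'}`.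
[folklore] -/
private theorem dotProduct_mulVec_prod_single (ρ : Matrix (m × n) (m × n) ℂ) (v : m → ℂ) (l : n) :
    star (fun q : m × n => v q.1 * (Pi.single l (1 : ℂ) : n → ℂ) q.2) ⬝ᵥ
        (ρ *ᵥ fun q : m × n => v q.1 * (Pi.single l (1 : ℂ) : n → ℂ) q.2) =
      ∑ k, ∑ k', star (v k) * ρ (k, l) (k', l) * v k' := by
  rw [star_prod_single]
  simp only [dotProduct, Matrix.mulVec, Fintype.sum_prod_type, Pi.single_apply, mul_ite, mul_one,
    mul_zero, Finset.sum_ite_eq', Finset.mem_univ, if_true, ite_mul, zero_mul]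
  refine Finset.sum_congr rfl fun k _ => ?_
  rw [Finset.mul_sum]
  refine Finset.sum_congr rfl fun k' _ => ?_
  ring

omit [DecidableEq m] in
/-- Summing the slices over `l` gives the quadratic form of the marginal:
`Σ_l ⟨v ⊗ e_l, ρ (v ⊗ e_l)⟩ = ⟨v, (Tr_Y ρ) v⟩`. [cite: NielsenChuang2010, §2.4.3 eq. (2.178)] -/
private theorem sum_dotProduct_mulVec_prod_single (ρ : Matrix (m × n) (m × n) ℂ) (v : m → ℂ) :
    ∑ l, star (fun q : m × n => v q.1 * (Pi.single l (1 : ℂ) : n → ℂ) q.2) ⬝ᵥ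
        (ρ *ᵥ fun q : m × n => v q.1 * (Pi.single l (1 : ℂ) : n → ℂ) q.2) =
      star v ⬝ᵥ (traceRight ρ *ᵥ v) := by
  simp_rw [dotProduct_mulVec_prod_single]
  simp only [dotProduct, Matrix.mulVec, Pi.star_apply, traceRight_apply, Finset.mul_sum,
    Finset.sum_mul]
  rw [Finset.sum_comm]
  refine Finset.sum_congr rfl fun k _ => ?_
  rw [Finset.sum_comm]
  refine Finset.sum_congr rfl fun k' _ => Finset.sum_congr rfl fun l _ => ?_
  ring

omit [DecidableEq m] in
/-- **The support of a state lies over the support of its marginal** (the fact behind Watrous'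
(5.109) `im(ρ) ⊆ im(ρ[X] ⊗ ρ[Y])`): for `ρ ⪰ 0` on `ℋ_X ⊗ ℋ_Y`, if `(Tr_Y ρ) v = 0` then
`ρ (v ⊗ w) = 0` for every `w`. [cite: Watrous2018, Theorem 5.24 (proof, eq. (5.109))] -/
theorem mulVec_prod_eq_zero_of_traceRight {ρ : Matrix (m × n) (m × n) ℂ} (hρ : ρ.PosSemidef)
    {v : m → ℂ} (hv : traceRight ρ *ᵥ v = 0) (w : n → ℂ) :
    ρ *ᵥ (fun q : m × n => v q.1 * w q.2) = 0 := by
  -- every slice of the quadratic form vanishes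
  have hsum : ∑ l, star (fun q : m × n => v q.1 * (Pi.single l (1 : ℂ) : n → ℂ) q.2) ⬝ᵥ
      (ρ *ᵥ fun q : m × n => v q.1 * (Pi.single l (1 : ℂ) : n → ℂ) q.2) = 0 := by
    rw [sum_dotProduct_mulVec_prod_single, hv, dotProduct_zero]
  have hslice : ∀ l, ρ *ᵥ (fun q : m × n => v q.1 * (Pi.single l (1 : ℂ) : n → ℂ) q.2) = 0 := by
    intro l
    have h0 := (Finset.sum_eq_zero_iff_of_nonneg (fun l _ => hρ.dotProduct_mulVec_nonneg
      (fun q : m × n => v q.1 * (Pi.single l (1 : ℂ) : n → ℂ) q.2))).1 hsum l (Finset.mem_univ l)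
    exact (hρ.dotProduct_mulVec_zero_iff _).1 h0
  -- linearity in `w`
  have hentry : ∀ (q : m × n) (l : n), ∑ k, ρ q (k, l) * v k = 0 := by
    intro q l
    have h := congrFun (hslice l) q
    simp only [Matrix.mulVec, dotProduct, Fintype.sum_prod_type, Pi.single_apply, mul_ite, mul_one,
      mul_zero, Finset.sum_ite_eq', Finset.mem_univ, if_true, Pi.zero_apply] at h
    exact h
  funext q
  simp only [Matrix.mulVec, dotProduct, Fintype.sum_prod_type, Pi.zero_apply]
  calc ∑ k, ∑ l, ρ q (k, l) * (v k * w l) = ∑ l, w l * ∑ k, ρ q (k, l) * v k := by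
        rw [Finset.sum_comm]
        refine Finset.sum_congr rfl fun l _ => ?_
        rw [Finset.mul_sum]
        refine Finset.sum_congr rfl fun k _ => ?_
        ring
    _ = 0 := Finset.sum_eq_zero fun l _ => by rw [hentry q l, mul_zero]

omit [DecidableEq n] in
/-- The same over the other marginal: if `(Tr_X ρ) w = 0` then `ρ (v ⊗ w) = 0` for every `v`
(by the swap `ℋ_X ⊗ ℋ_Y ≃ ℋ_Y ⊗ ℋ_X`). [cite: Watrous2018, Theorem 5.24 (proof, eq. (5.109))] -/
theorem mulVec_prod_eq_zero_of_traceLeft {ρ : Matrix (m × n) (m × n) ℂ} (hρ : ρ.PosSemidef)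
    {w : n → ℂ} (hw : traceLeft ρ *ᵥ w = 0) (v : m → ℂ) :
    ρ *ᵥ (fun q : m × n => v q.1 * w q.2) = 0 := by
  -- swap the factors
  set σ : Matrix (n × m) (n × m) ℂ := ρ.submatrix Prod.swap Prod.swap with hσ
  have hσpsd : σ.PosSemidef := hρ.submatrix Prod.swap
  have hσR : traceRight σ = traceLeft ρ := by
    ext b b'
    simp [hσ, traceRight_apply, traceLeft_apply]
  have h := mulVec_prod_eq_zero_of_traceRight hσpsd (by rw [hσR, hw]) v
  funext q
  have hq := congrFun h q.swap
  simp only [Matrix.mulVec, dotProduct, hσ, Matrix.submatrix_apply, Prod.swap_swap, Pi.zero_apply,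
    Fintype.sum_prod_type] at hq ⊢
  rw [Finset.sum_comm] at hq
  rw [← hq]
  refine Finset.sum_congr rfl fun k _ => Finset.sum_congr rfl fun l _ => ?_
  simp only [Prod.swap_prod_mk]
  ring

/-- **Watrous (5.110)**: for `ρ ⪰ 0` on `ℋ_X ⊗ ℋ_Y`,
`D(ρ ‖ ρ[X] ⊗ ρ[Y]) = H(ρ[X]) + H(ρ[Y]) − H(ρ)` (`ρ[X] = Tr_Y ρ = traceRight ρ`,
`ρ[Y] = Tr_X ρ = traceLeft ρ`) — the quantum mutual information as a relative entropy.
[cite: Watrous2018, Theorem 5.24 (proof, eq. (5.110))] [cite: NielsenChuang2010, §11.3.4 (proof of subadditivity)] -/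
theorem quantumRelEntropy_kronecker_marginals {ρ : Matrix (m × n) (m × n) ℂ} (hρ : ρ.PosSemidef) :
    quantumRelEntropy ρ (traceRight ρ ⊗ₖ traceLeft ρ) =
      vonNeumannEntropy (traceRight ρ) + vonNeumannEntropy (traceLeft ρ) - vonNeumannEntropy ρ := by
  have hX : (traceRight ρ).IsHermitian := (posSemidef_traceRight hρ).1
  have hY : (traceLeft ρ).IsHermitian := (posSemidef_traceLeft hρ).1
  unfold quantumRelEntropy
  rw [Matrix.mul_sub, Matrix.trace_sub, Complex.sub_re, re_trace_mul_cfc_log hρ.1,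
    trace_mul_log_kronecker hX hY (fun v w hv => mulVec_prod_eq_zero_of_traceRight hρ hv w)
      (fun v w hw => mulVec_prod_eq_zero_of_traceLeft hρ hw v),
    Complex.add_re, Matrix.trace_mul_comm ρ (cfc Real.log (traceRight ρ) ⊗ₖ _),
    Matrix.trace_mul_comm ρ (_ ⊗ₖ cfc Real.log (traceLeft ρ)), ← trace_mul_traceRight_eq_kronecker,
    ← trace_mul_traceLeft_eq_kronecker, Matrix.trace_mul_comm (cfc Real.log (traceRight ρ)),
    Matrix.trace_mul_comm (cfc Real.log (traceLeft ρ)), re_trace_mul_cfc_log hX,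
    re_trace_mul_cfc_log hY]
  ring

end Marginals

/-! ### §3 Subadditivity (Watrous Theorem 5.24) and the Araki–Lieb inequality (Theorem 5.25) -/

section Subadditivity

/-- **Subadditivity of the von Neumann entropy** (Watrous Theorem 5.24, Nielsen–Chuang §11.3.4):
for every state `ρ` of a pair of registers, `H(X, Y) ≤ H(X) + H(Y)`, i.e.
`H(ρ) ≤ H(Tr_Y ρ) + H(Tr_X ρ)`. Proof as printed: (5.110) and Klein's inequality for the pair
`(ρ, ρ[X] ⊗ ρ[Y])`, whose supports are nested by (5.109).
[cite: Watrous2018, Theorem 5.24] [cite: NielsenChuang2010, §11.3.4 eq. (11.72)] -/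
theorem vonNeumannEntropy_le_add_marginals {ρ : Matrix (m × n) (m × n) ℂ} (hρ : IsDensity ρ) :
    vonNeumannEntropy ρ ≤ vonNeumannEntropy (traceRight ρ) + vonNeumannEntropy (traceLeft ρ) := by
  have hX := isDensity_traceRight hρ
  have hY := isDensity_traceLeft hρ
  have hprod : IsDensity (traceRight ρ ⊗ₖ traceLeft ρ) :=
    ⟨hX.1.kronecker hY.1, by rw [trace_kronecker, hX.2, hY.2, mul_one]⟩
  have hker : ∀ v : m × n → ℂ, (traceRight ρ ⊗ₖ traceLeft ρ) *ᵥ v = 0 → ρ *ᵥ v = 0 :=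
    mulVec_eq_zero_of_kronecker_mulVec_eq_zero hX.1.1 hY.1.1
      (fun v w hv => mulVec_prod_eq_zero_of_traceRight hρ.1 hv w)
      (fun v w hw => mulVec_prod_eq_zero_of_traceLeft hρ.1 hw v)
  have h := quantumRelEntropy_nonneg hρ hprod hker
  rw [quantumRelEntropy_kronecker_marginals hρ.1] at h
  linarith

/-- **The quantum mutual information is nonnegative**: `I(X : Y) = H(X) + H(Y) − H(X,Y) ≥ 0`
(equivalent form of subadditivity). [cite: Watrous2018, Theorem 5.24 and eq. (5.91)] -/
theorem mutualInformation_nonneg {ρ : Matrix (m × n) (m × n) ℂ} (hρ : IsDensity ρ) :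
    0 ≤ vonNeumannEntropy (traceRight ρ) + vonNeumannEntropy (traceLeft ρ) - vonNeumannEntropy ρ := by
  linarith [vonNeumannEntropy_le_add_marginals hρ]

omit [Fintype m] [DecidableEq m] [DecidableEq n] in
/-- Reshaping a purification: for `M` indexed by `(X × Y) × Z`, the matrix `N_{(y,z),x} = M_{(x,y),z}`
satisfies `N⋆N = (Tr_Y (M M⋆))ᵀ`. [cite: Watrous2018, Theorem 5.25 (proof, eq. (5.116))] -/
private theorem reshape_conjTranspose_mul_self {k : Type*} [Fintype k] (M : Matrix (m × n) k ℂ) :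
    (Matrix.of fun (p : n × k) (x : m) => M (x, p.1) p.2)ᴴ *
        (Matrix.of fun (p : n × k) (x : m) => M (x, p.1) p.2) = (traceRight (M * Mᴴ))ᵀ := by
  ext x x'
  simp only [Matrix.mul_apply, conjTranspose_apply, Matrix.of_apply, transpose_apply,
    traceRight_apply, Fintype.sum_prod_type]
  exact Finset.sum_congr rfl fun y _ => Finset.sum_congr rfl fun z _ => mul_comm _ _

omit [DecidableEq m] [Fintype n] [DecidableEq n] in
/-- Reshaping a purification: `Tr_Z (N N⋆) = Tr_X (M M⋆)`. [cite: Watrous2018, Theorem 5.25 (proof, eq. (5.116))] -/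
private theorem traceRight_reshape_mul_conjTranspose {k : Type*} [Fintype k]
    (M : Matrix (m × n) k ℂ) :
    traceRight ((Matrix.of fun (p : n × k) (x : m) => M (x, p.1) p.2) *
        (Matrix.of fun (p : n × k) (x : m) => M (x, p.1) p.2)ᴴ) = traceLeft (M * Mᴴ) := by
  ext y y'
  simp only [Matrix.mul_apply, conjTranspose_apply, Matrix.of_apply, traceRight_apply,
    traceLeft_apply]
  rw [Finset.sum_comm]

omit [DecidableEq m] [DecidableEq n] in
/-- Reshaping a purification: `Tr_Y (N N⋆) = (M⋆ M)ᵀ`. [cite: Watrous2018, Theorem 5.25 (proof, eq. (5.116))] -/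
private theorem traceLeft_reshape_mul_conjTranspose {k : Type*} [Fintype k]
    (M : Matrix (m × n) k ℂ) :
    traceLeft ((Matrix.of fun (p : n × k) (x : m) => M (x, p.1) p.2) *
        (Matrix.of fun (p : n × k) (x : m) => M (x, p.1) p.2)ᴴ) = (Mᴴ * M)ᵀ := by
  ext z z'
  simp only [Matrix.mul_apply, conjTranspose_apply, Matrix.of_apply, traceLeft_apply,
    transpose_apply, Fintype.sum_prod_type]
  rw [Finset.sum_comm]
  exact Finset.sum_congr rfl fun x _ => Finset.sum_congr rfl fun y _ => mul_comm _ _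

/-- **Araki–Lieb / Watrous Theorem 5.25**: for every state `ρ` of a pair of registers,
`H(X) ≤ H(Y) + H(X, Y)`, i.e. `H(Tr_Y ρ) ≤ H(Tr_X ρ) + H(ρ)`. Proof as printed: purify `ρ = M M⋆`
(`M = √ρ`) to the pure state `vec M` of `(X, Y, Z)`; then `H(X) = H(Y, Z)` and `H(X, Y) = H(Z)`
((5.116), via the mirror lemma `H(N N⋆) = H(N⋆ N)`), and subadditivity on `(Y, Z)` gives (5.114).
[cite: Watrous2018, Theorem 5.25] [cite: NielsenChuang2010, §11.3.4 eq. (11.73) (Araki–Lieb triangle inequality)] -/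
theorem vonNeumannEntropy_traceRight_le {ρ : Matrix (m × n) (m × n) ℂ} (hρ : IsDensity ρ) :
    vonNeumannEntropy (traceRight ρ) ≤ vonNeumannEntropy (traceLeft ρ) + vonNeumannEntropy ρ := by
  -- purification `ρ = M M⋆`, `M = √ρ`
  obtain ⟨M, hMdef⟩ : ∃ M : Matrix (m × n) (m × n) ℂ, M = cfc Real.sqrt ρ := ⟨_, rfl⟩
  have hMh : Mᴴ = M := by rw [hMdef]; exact isHermitian_cfc ρ Real.sqrt
  have hMM : M * Mᴴ = ρ := by rw [hMh, hMdef]; exact cfc_sqrt_mul_self hρ.1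
  have hMM' : Mᴴ * M = ρ := by rw [hMh, ← hMM, hMh]
  -- the reshaped purification `N` on `Y ⊗ Z ← X`
  set N : Matrix (n × (m × n)) m ℂ := Matrix.of fun (p : n × (m × n)) (x : m) => M (x, p.1) p.2
    with hN
  have h1 : Nᴴ * N = (traceRight ρ)ᵀ := by rw [hN, reshape_conjTranspose_mul_self, hMM]
  have h2 : traceRight (N * Nᴴ) = traceLeft ρ := by
    rw [hN, traceRight_reshape_mul_conjTranspose, hMM]
  have h3 : traceLeft (N * Nᴴ) = ρᵀ := by rw [hN, traceLeft_reshape_mul_conjTranspose, hMM']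
  -- `N N⋆` is a state of `(Y, Z)`
  have hX : (traceRight ρ).IsHermitian := (posSemidef_traceRight hρ.1).1
  have hNN : IsDensity (N * Nᴴ) := by
    refine ⟨Matrix.posSemidef_self_mul_conjTranspose N, ?_⟩
    rw [Matrix.trace_mul_comm, h1, Matrix.trace_transpose, trace_traceRight, hρ.2]
  have hsub := vonNeumannEntropy_le_add_marginals hNN
  rw [h2, h3, vonNeumannEntropy_transpose hρ.1.1, vonNeumannEntropy_mul_conjTranspose_comm N, h1,
    vonNeumannEntropy_transpose hX] at hsub
  exact hsub

/-- **Theorem 5.25, the other register**: `H(Y) ≤ H(X) + H(X, Y)`, i.e.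
`H(Tr_X ρ) ≤ H(Tr_Y ρ) + H(ρ)` (swap the factors). [cite: Watrous2018, Theorem 5.25] -/
theorem vonNeumannEntropy_traceLeft_le {ρ : Matrix (m × n) (m × n) ℂ} (hρ : IsDensity ρ) :
    vonNeumannEntropy (traceLeft ρ) ≤ vonNeumannEntropy (traceRight ρ) + vonNeumannEntropy ρ := by
  set σ : Matrix (n × m) (n × m) ℂ := ρ.submatrix Prod.swap Prod.swap with hσ
  have hσR : traceRight σ = traceLeft ρ := by
    ext b b'
    simp [hσ, traceRight_apply, traceLeft_apply]
  have hσL : traceLeft σ = traceRight ρ := traceLeft_submatrix_swap ρ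
  have hσtr : σ.trace = 1 := by rw [← trace_traceLeft, hσL, trace_traceRight, hρ.2]
  have hσd : IsDensity σ := ⟨hρ.1.submatrix Prod.swap, hσtr⟩
  have hS : vonNeumannEntropy σ = vonNeumannEntropy ρ :=
    vonNeumannEntropy_submatrix_equiv hρ.1.1 (Equiv.prodComm n m)
  have h := vonNeumannEntropy_traceRight_le hσd
  rwa [hσR, hσL, hS] at h

/-- **Araki–Lieb triangle inequality** `|H(X) − H(Y)| ≤ H(X, Y)`.
[cite: Watrous2018, Theorem 5.25] [cite: NielsenChuang2010, §11.3.4 eq. (11.73)] -/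
theorem abs_vonNeumannEntropy_marginals_sub_le {ρ : Matrix (m × n) (m × n) ℂ} (hρ : IsDensity ρ) :
    |vonNeumannEntropy (traceRight ρ) - vonNeumannEntropy (traceLeft ρ)| ≤ vonNeumannEntropy ρ := by
  rw [abs_sub_le_iff]
  constructor
  · linarith [vonNeumannEntropy_traceRight_le hρ]
  · linarith [vonNeumannEntropy_traceLeft_le hρ]

end Subadditivity

/-! ### §4 The relative entropy of Kronecker products (Watrous Proposition 5.21) -/

section KroneckerRelEntropy

omit [DecidableEq m] [DecidableEq n] in
/-- `(A ⊗ B)(v ⊗ w) = (A v) ⊗ (B w)` — the defining property of the tensor product of operators.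
[cite: Watrous2018, §1.1.2 eq. (1.68)] -/
theorem kronecker_mulVec_prod (A : Matrix m m ℂ) (B : Matrix n n ℂ) (v : m → ℂ) (w : n → ℂ) :
    (A ⊗ₖ B) *ᵥ (fun q : m × n => v q.1 * w q.2) =
      fun q : m × n => (A *ᵥ v) q.1 * (B *ᵥ w) q.2 := by
  funext q
  simp only [Matrix.mulVec, dotProduct, Matrix.kroneckerMap_apply, Fintype.sum_prod_type]
  rw [Finset.sum_mul_sum]
  refine Finset.sum_congr rfl fun i _ => Finset.sum_congr rfl fun j _ => ?_
  ring

/-- The trace of a Hermitian matrix is real (it is the sum of the real eigenvalues).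
[cite: Watrous2018, §1.1.3 Corollary 1.4 eq. (1.137) (Hermitian operators have real eigenvalues)] -/
theorem im_trace_eq_zero_of_isHermitian {k : Type*} [Fintype k] [DecidableEq k] {A : Matrix k k ℂ}
    (hA : A.IsHermitian) : A.trace.im = 0 := by
  rw [hA.trace_eq_sum_eigenvalues]
  simp

/-- **Watrous Proposition 5.21**: `D(P₀ ⊗ P₁ ‖ Q₀ ⊗ Q₁) = Tr(P₁) D(P₀‖Q₀) + Tr(P₀) D(P₁‖Q₁)` for
Hermitian `P₀, P₁, Q₀, Q₁` with `im(P₀) ⊆ im(Q₀)` and `im(P₁) ⊆ im(Q₁)` (the finite case of (5.97);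
the source assumes `P₀, P₁ ≠ 0` only to read `0 · ∞`). [cite: Watrous2018, Proposition 5.21 eq. (5.97)] -/
theorem quantumRelEntropy_kronecker {P₀ Q₀ : Matrix m m ℂ} {P₁ Q₁ : Matrix n n ℂ}
    (hP₀ : P₀.IsHermitian) (hP₁ : P₁.IsHermitian) (hQ₀ : Q₀.IsHermitian) (hQ₁ : Q₁.IsHermitian)
    (hk₀ : ∀ v : m → ℂ, Q₀ *ᵥ v = 0 → P₀ *ᵥ v = 0) (hk₁ : ∀ w : n → ℂ, Q₁ *ᵥ w = 0 → P₁ *ᵥ w = 0) :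
    quantumRelEntropy (P₀ ⊗ₖ P₁) (Q₀ ⊗ₖ Q₁) =
      P₁.trace.re * quantumRelEntropy P₀ Q₀ + P₀.trace.re * quantumRelEntropy P₁ Q₁ := by
  -- support hypotheses for `ρ = P₀ ⊗ P₁` against `(P₀, P₁)` and against `(Q₀, Q₁)`
  have hsP : ∀ (v : m → ℂ) (w : n → ℂ), P₀ *ᵥ v = 0 →
      (P₀ ⊗ₖ P₁) *ᵥ (fun q : m × n => v q.1 * w q.2) = 0 := fun v w hv => by
    rw [kronecker_mulVec_prod, hv]; funext q; simp
  have hsP' : ∀ (v : m → ℂ) (w : n → ℂ), P₁ *ᵥ w = 0 →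
      (P₀ ⊗ₖ P₁) *ᵥ (fun q : m × n => v q.1 * w q.2) = 0 := fun v w hw => by
    rw [kronecker_mulVec_prod, hw]; funext q; simp
  have htr : ∀ (X : Matrix m m ℂ) (Y : Matrix n n ℂ),
      ((P₀ ⊗ₖ P₁) * (X ⊗ₖ (1 : Matrix n n ℂ))).trace + ((P₀ ⊗ₖ P₁) * ((1 : Matrix m m ℂ) ⊗ₖ Y)).trace =
        P₁.trace * (P₀ * X).trace + P₀.trace * (P₁ * Y).trace := by
    intro X Y
    rw [← mul_kronecker_mul, ← mul_kronecker_mul, trace_kronecker, trace_kronecker, Matrix.mul_one,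
      Matrix.mul_one]
    ring
  have hi₀ := im_trace_eq_zero_of_isHermitian hP₀
  have hi₁ := im_trace_eq_zero_of_isHermitian hP₁
  unfold quantumRelEntropy
  rw [Matrix.mul_sub, Matrix.trace_sub,
    trace_mul_log_kronecker hP₀ hP₁ hsP hsP',
    trace_mul_log_kronecker hQ₀ hQ₁ (fun v w hv => hsP v w (hk₀ v hv)) (fun v w hw => hsP' v w (hk₁ w hw)),
    htr, htr, Matrix.mul_sub, Matrix.mul_sub, Matrix.trace_sub, Matrix.trace_sub]
  simp only [Complex.sub_re, Complex.add_re, Complex.mul_re, hi₀, hi₁, zero_mul, sub_zero]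
  ring

/-- **Additivity of the relative entropy on product states**: for Hermitian unit-trace
`ρ₀, ρ₁, σ₀, σ₁` with nested supports, `D(ρ₀ ⊗ ρ₁ ‖ σ₀ ⊗ σ₁) = D(ρ₀‖σ₀) + D(ρ₁‖σ₁)`.
[cite: Watrous2018, Proposition 5.21 eq. (5.97)] -/
theorem quantumRelEntropy_kronecker_of_trace_eq_one {ρ₀ σ₀ : Matrix m m ℂ} {ρ₁ σ₁ : Matrix n n ℂ}
    (hρ₀ : ρ₀.IsHermitian) (hρ₁ : ρ₁.IsHermitian) (hσ₀ : σ₀.IsHermitian) (hσ₁ : σ₁.IsHermitian)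
    (ht₀ : ρ₀.trace = 1) (ht₁ : ρ₁.trace = 1)
    (hk₀ : ∀ v : m → ℂ, σ₀ *ᵥ v = 0 → ρ₀ *ᵥ v = 0) (hk₁ : ∀ w : n → ℂ, σ₁ *ᵥ w = 0 → ρ₁ *ᵥ w = 0) :
    quantumRelEntropy (ρ₀ ⊗ₖ ρ₁) (σ₀ ⊗ₖ σ₁) = quantumRelEntropy ρ₀ σ₀ + quantumRelEntropy ρ₁ σ₁ := by
  rw [quantumRelEntropy_kronecker hρ₀ hρ₁ hσ₀ hσ₁ hk₀ hk₁, ht₀, ht₁, Complex.one_re, one_mul, one_mul,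
    add_comm]

/-- **Appending an uncorrelated register does not change the relative entropy**:
`D(P ⊗ ω ‖ Q ⊗ ω) = D(P‖Q)` for Hermitian `P, Q` with `im P ⊆ im Q` and a unit-trace Hermitian `ω`
(Watrous (5.179), the last step of the proof of Theorem 5.35). [cite: Watrous2018, Theorem 5.35 (proof, eq. (5.179))] -/
theorem quantumRelEntropy_kronecker_right {P Q : Matrix m m ℂ} {ω : Matrix n n ℂ} (hP : P.IsHermitian)
    (hQ : Q.IsHermitian) (hω : ω.IsHermitian) (hωtr : ω.trace = 1)
    (hk : ∀ v : m → ℂ, Q *ᵥ v = 0 → P *ᵥ v = 0) :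
    quantumRelEntropy (P ⊗ₖ ω) (Q ⊗ₖ ω) = quantumRelEntropy P Q := by
  rw [quantumRelEntropy_kronecker hP hω hQ hω hk (fun _ h => h), quantumRelEntropy_self, mul_zero,
    add_zero, hωtr, Complex.one_re, one_mul]

end KroneckerRelEntropy

/-! ### §5 Relative entropy to `ω ⊗ ρ[Y]` (Watrous (5.182)–(5.183)) -/

section UniformMarginal

/-- `f(c𝟙) = f(c)𝟙` (plumbing; a public copy is `Literature.Analysis.Complex.cfc_smul_one`). [folklore] -/
private theorem cfc_smul_one' (c : ℝ) (f : ℝ → ℝ) :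
    cfc f (((c : ℝ) : ℂ) • (1 : Matrix m m ℂ)) = ((f c : ℝ) : ℂ) • (1 : Matrix m m ℂ) := by
  have h1 : (1 : Matrix m m ℂ) ∈ Matrix.unitaryGroup m ℂ := one_mem _
  have h : ((c : ℝ) : ℂ) • (1 : Matrix m m ℂ) =
      1 * diagonal (fun _ : m => ((c : ℝ) : ℂ)) * star (1 : Matrix m m ℂ) := by
    rw [Matrix.one_mul, star_one, Matrix.mul_one, Matrix.smul_one_eq_diagonal]
  rw [cfc_eq_conj_diagonal h1 h f, Matrix.one_mul, star_one, Matrix.mul_one, Matrix.smul_one_eq_diagonal]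
  rfl

/-- **`D(ρ ‖ A ⊗ ρ[Y]) = −H(ρ) − Re Tr(ρ[X] log A) + H(ρ[Y])`** for `ρ ⪰ 0` on `ℋ_X ⊗ ℋ_Y` and a
Hermitian `A` on `ℋ_X` whose kernel vectors `x` satisfy `ρ (x ⊗ y) = 0` (e.g. `A ≻ 0`): the common
shape of Watrous' (5.110) (`A = ρ[X]`) and (5.182)–(5.183) (`A = ω = 𝟙/dim X`).
[cite: Watrous2018, Theorem 5.36 (proof, eqs. (5.182)–(5.183))] -/
theorem quantumRelEntropy_kronecker_traceLeft {ρ : Matrix (m × n) (m × n) ℂ} (hρ : ρ.PosSemidef)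
    {A : Matrix m m ℂ} (hA : A.IsHermitian)
    (hkA : ∀ (v : m → ℂ) (w : n → ℂ), A *ᵥ v = 0 → ρ *ᵥ (fun q : m × n => v q.1 * w q.2) = 0) :
    quantumRelEntropy ρ (A ⊗ₖ traceLeft ρ) =
      - vonNeumannEntropy ρ - ((traceRight ρ * cfc Real.log A).trace).re
        + vonNeumannEntropy (traceLeft ρ) := by
  have hY : (traceLeft ρ).IsHermitian := (posSemidef_traceLeft hρ).1
  unfold quantumRelEntropy
  rw [Matrix.mul_sub, Matrix.trace_sub, Complex.sub_re, re_trace_mul_cfc_log hρ.1,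
    trace_mul_log_kronecker hA hY hkA (fun v w hw => mulVec_prod_eq_zero_of_traceLeft hρ hw v),
    Complex.add_re, Matrix.trace_mul_comm ρ (cfc Real.log A ⊗ₖ _),
    Matrix.trace_mul_comm ρ (_ ⊗ₖ cfc Real.log (traceLeft ρ)), ← trace_mul_traceRight_eq_kronecker,
    ← trace_mul_traceLeft_eq_kronecker, Matrix.trace_mul_comm (cfc Real.log A),
    Matrix.trace_mul_comm (cfc Real.log (traceLeft ρ)), re_trace_mul_cfc_log hY]
  ring

/-- **Watrous (5.182)**: `D(ρ[X,Y] ‖ ω ⊗ ρ[Y]) = −H(X,Y) + H(Y) + log(dim X)` for a state `ρ` and the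
completely mixed state `ω = 𝟙/dim X` — the conditional entropy as a relative entropy,
`H(X|Y) = log(dim X) − D(ρ ‖ ω ⊗ ρ[Y])`. [cite: Watrous2018, Theorem 5.36 (proof, eq. (5.182))]
[cite: NielsenChuang2010, §11.4.1 eq. (11.106)] -/
theorem quantumRelEntropy_uniform_kronecker_traceLeft [Nonempty m] {ρ : Matrix (m × n) (m × n) ℂ}
    (hρ : IsDensity ρ) :
    quantumRelEntropy ρ (((((Fintype.card m : ℝ)⁻¹ : ℝ) : ℂ) • (1 : Matrix m m ℂ)) ⊗ₖ traceLeft ρ) =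
      - vonNeumannEntropy ρ + vonNeumannEntropy (traceLeft ρ) + Real.log (Fintype.card m) := by
  have hc : ((Fintype.card m : ℝ)⁻¹ : ℝ) ≠ 0 := inv_ne_zero (Nat.cast_ne_zero.2 Fintype.card_ne_zero)
  have hA : ((((Fintype.card m : ℝ)⁻¹ : ℝ) : ℂ) • (1 : Matrix m m ℂ)).IsHermitian := by
    rw [Matrix.smul_one_eq_diagonal]
    exact Matrix.isHermitian_diagonal_of_self_adjoint _ (funext fun _ => by simp)
  have hkA : ∀ (v : m → ℂ) (w : n → ℂ), ((((Fintype.card m : ℝ)⁻¹ : ℝ) : ℂ) • (1 : Matrix m m ℂ)) *ᵥ v = 0 →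
      ρ *ᵥ (fun q : m × n => v q.1 * w q.2) = 0 := by
    intro v w hv
    rw [Matrix.smul_mulVec, Matrix.one_mulVec, smul_eq_zero] at hv
    rcases hv with h | h
    · exact absurd (Complex.ofReal_eq_zero.1 h) hc
    · rw [h]
      funext q
      simp [Matrix.mulVec, dotProduct]
  rw [quantumRelEntropy_kronecker_traceLeft hρ.1 hA hkA, cfc_smul_one', Matrix.mul_smul, Matrix.mul_one,
    Matrix.trace_smul, smul_eq_mul, Complex.re_ofReal_mul, trace_traceRight, hρ.2, Complex.one_re,
    mul_one, Real.log_inv]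
  ring

end UniformMarginal

end Literature.InformationTheory.Entropy
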